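import Literature.Computability.AlgebraicComplexity.MS21DiagonalTensorDifferenceLemmas
import HarnessLib

/-!
# Medini–Shpilka 2021, Thm 45: uniform `6`-independent maps hit `T_{s₁,d₁}^{GL_n} - T_{s₂,d₂}^{GL_n}`
# (assembly of the printed proof; characteristic `0` or `> min(d₁, d₂)`)

Theorem-only file (cell `val-lit`, seat x6 g3) for the typed fact
`Literature.Computability.AlgebraicComplexity.MS2021_thm_45` [MediniShpilka2021, Thm 45 (CCC
p.19:14) = arXiv ‹PITsumSDMinv› p0009:L9-L12; proof §6.2, p0036:L1-L52]:

> "Let `n, s₁, s₂, d₁, d₂ ∈ ℕ` be such that `n ≥ s₁d₁, s₂d₂`. For `i ∈ {1,2}` let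
> `f_i ∈ T_{s_i,d_i}^{GL_n(F)}`, and let `f = f₁ - f₂`. If `f ≠ 0`, then any uniform `6`-independent
> `G` satisfies `f ∘ G ≠ 0`."

MAIN RESULTS
* `MS2021.thm_45_of_cast_ne_zero` — the statement of the fact for every field `K` in which
  `2, 3, …, min(d₁, d₂)` are nonzero (i.e. `char K = 0` or `char K > min(d₁, d₂)`);
* `MS2021.thm_45_of_charZero` — the characteristic-`0` instance, in the exact binder shape of the
  fact's body.

The all-fields fact `MS2021_thm_45` is NOT discharged by this file: see CHARACTERISTIC NOTE.

PROOF (the printed case analysis, p0036, followed step by step; the algebra of each step is in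
`MS21DiagonalTensorDifferenceLemmas.lean`, the engine — Lemma 6.2 / Cor 6.3, "`(k+2)`-independent
maps hit nonzero `k`-th directional derivatives of `T^{GLaff}` polynomials" — is seat t18 g5's
`MS21DiagonalTensorDerivatives.lean`, and Lemma 3.9 (peeling one `1`-independent block per
directional derivative) is seat t24 g5's `MS21IndependentMapLemmas.lean`):
1. "if `f ∘ G₆ = 0` then `d₁ = d₂`" (p0036:L5-L9): `f_i` is homogeneous of degree `d_i`, `G` is
   uniform of some degree `e ≥ 1`, so `f_i ∘ G` is homogeneous of degree `d_i e`; the nonzero one(s)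
   survive by Cor 6.3, and two nonzero homogeneous polynomials of different degrees do not cancel
   (`bind₁_sub_ne_zero_of_degree_ne`).
2. `d₁ = d₂ = d`. `d = 0`: `f` is a nonzero constant. `d = 1`: `f` is a nonzero linear form, hit by
   any `1`-independent map (`bind₁_ne_zero_of_isHomogeneous_one`). `d ≥ 2`:
   (a) some `ℓ_{2,v₀} ∉ span{ℓ_{1,w}}` (this covers the printed "`s₁ ≠ s₂`" and "spans differ" cases,
   p0036:L16-L24, with the roles of `f₁`, `f₂` chosen so that no cardinality count is needed): along a
   vector `v` with `ℓ_{2,v₀}(v) = 1`, `ℓ_{1,w}(v) = 0` one has `∂f₁/∂v = 0 ≠ ∂f₂/∂v`, and the engine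
   (`k = 1`, a `5`-independent tail) plus one peeled block finish (`bind₁_sub_ne_zero_of_notMem_span`);
   (b) every `ℓ_{2,v}` lies in `span{ℓ_{1,w}}` (p0036:L26-L50): write `f₂ = P(ℓ_1)` with
   `P = T'_{s₂,d} ∘ M`; Case A (all monomials of `P` are row monomials of `T'_{s₁,d}`): `f = Q(ℓ_1)`
   with `Q` a combination of row monomials, and `∂f/∂v_{(a₀,0)} = c · ∏_{j ≠ 0} ℓ_{1,a₀,j}` with
   `c ≠ 0` is a product of nonzero linear forms, hit by the `5`-independent tail (the printed text
   invokes Cor 6.3 on `f ∈ T_{s,d}^{GL}` instead; some `1 + α_i` may vanish, so we differentiate once —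
   same budget); Case B (a non-row monomial `x^α` of `P`): two dual directions `u, w` with
   `∂²f₁/∂u∂w = 0 ≠ ∂²f₂/∂u∂w` — `α` multilinear: two variables of `α` in different rows
   (p0036:L44-L47); `α_v ≥ 2`: `u = w = v_v` (p0036:L38-L42) — then the engine (`k = 2`, a
   `4`-independent tail) and two peeled blocks (`bind₁_sub_ne_zero_of_forall_mem_span`).

CHARACTERISTIC NOTE. In the sub-case `α_v ≥ 2` the coefficient of `x^{α - 2e_v}` in `∂²P/∂x_v²` is
`α_v (α_v - 1) c_α` (`MS2021.coeff_pderiv_pderiv_of_two_le`); the printed "`≠ 0` as the monomial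
exists in `f₂`" (p0036:L41-L42) therefore needs `α_v (α_v - 1) ≠ 0` in `F`, automatic in
characteristic `0` and whenever `char F > d ≥ α_v`, but not in general (in characteristic `2`,
`s₁ = s₂ = 1`, `d = 2`, `ℓ_2 = (x₁, x₁ + x₂)` gives `f = -x₁²`, on which every second — indeed every
first — directional derivative vanishes, although `f ∘ G = -(x₁ ∘ G)² ≠ 0`). This is the ONLY
step of the printed proof that uses the characteristic; accordingly the theorems below carry the
hypothesis `∀ q, 2 ≤ q ≤ min(d₁,d₂) → (q : K) ≠ 0` (Step 1 needs nothing, so only `d = d₁ = d₂`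
matters). Whether the printed all-fields statement holds in characteristic `p ≤ min(d₁, d₂)` is
not decided here (PRINT-ERRATA candidate filed with the cell's registry, seat lit g7).

UNIFORMITY NOTE (registry item B34). The typed fact, like the printed STATEMENT, concerns the
LINEAR orbits `T^{GL_n}`; `f₁`, `f₂` are then homogeneous, and the homogenisation paragraph of the
printed proof (p0036:L10-L13, via ‹lem:uniIndGenHitsHom›) is not needed and not used: uniformity of
`G` (all coordinates of the block SUM homogeneous of one degree — the tree's `MS2021.IsUniform`,
= Def 19 verbatim) enters only Step 1, exactly as typed.

No definitions, no facts (D-0026). HONEST FRAMING: a 2021 published PIT theorem formalised under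
an explicit characteristic hypothesis; `VP ≠ VNP` is NOT proved; nothing here is load-bearing for it.

## References
* [MediniShpilka2021] D. Medini, A. Shpilka, *Hitting sets and reconstruction for dense orbits in
  VP_e and ΣΠΣ circuits*, CCC 2021 (LIPIcs 200:19), Thm 45; arXiv:2102.05632, statement
  p0009:L9-L12, proof §6.2 p0036:L1-L52, Lemma 6.2 / Cor 6.3 p0035, Lemma 3.9 p0018.
-/

noncomputable section

open MvPolynomial Matrix

namespace Literature.Computability.AlgebraicComplexity

namespace MS2021

/-! ### Small helpers -/

section Helpers

variable {K : Type*} [Field K] {m n : ℕ}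

/-- `g ↦ g(Ax+b)` is additive. [folklore] -/
private theorem affSubst_sub' (h : m ≤ n) (A : Matrix (Fin n) (Fin n) K) (b : Fin n → K)
    (p q : MvPolynomial (Fin m) K) :
    affSubst h A b (p - q) = affSubst h A b p - affSubst h A b q := by
  unfold affSubst
  exact map_sub _ _ _

/-- `g ↦ g(Ax+b)` maps `0` to `0`. [folklore] -/
private theorem affSubst_zero' (h : m ≤ n) (A : Matrix (Fin n) (Fin n) K) (b : Fin n → K) :
    affSubst h A b (0 : MvPolynomial (Fin m) K) = 0 := by
  unfold affSubst
  exact map_zero _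

/-- `g ↦ g(Ax+b)` commutes with negation. [folklore] -/
private theorem affSubst_neg' (h : m ≤ n) (A : Matrix (Fin n) (Fin n) K) (b : Fin n → K)
    (p : MvPolynomial (Fin m) K) : affSubst h A b (-p) = -affSubst h A b p := by
  unfold affSubst
  exact map_neg _ _

/-- Directional derivatives are additive. [folklore] -/
private theorem dirDeriv_sub' (v : Fin n → K) (p q : MvPolynomial (Fin n) K) :
    (∑ j, C (v j) * pderiv j (p - q)) = (∑ j, C (v j) * pderiv j p) - ∑ j, C (v j) * pderiv j q := by
  simp only [map_sub, mul_sub, Finset.sum_sub_distrib]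

/-- A degree-one exponent is a unit vector. [folklore] -/
private theorem exists_eq_single_of_degree_eq_one {σ : Type*} (m : σ →₀ ℕ) (hm : m.degree = 1) :
    ∃ j, m = Finsupp.single j 1 := by
  classical
  have hm0 : m ≠ 0 := by
    rintro rfl
    simp at hm
  obtain ⟨j, hj⟩ := Finsupp.ne_iff.1 hm0
  rw [Finsupp.zero_apply] at hj
  have h1 : m j ≤ 1 := hm ▸ Finsupp.le_degree j m
  have hmj : m j = 1 := le_antisymm h1 (Nat.one_le_iff_ne_zero.2 hj)
  have hle : Finsupp.single j 1 ≤ m := Finsupp.single_le_iff.2 (by rw [hmj])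
  have hsplit : m = Finsupp.single j 1 + (m - Finsupp.single j 1) :=
    (add_tsub_cancel_of_le hle).symm
  have hrest : (m - Finsupp.single j 1).degree = 0 := by
    have := congr_arg Finsupp.degree hsplit
    rw [map_add, Finsupp.degree_single, hm] at this
    omega
  rw [Finsupp.degree_eq_zero_iff] at hrest
  exact ⟨j, by rw [hsplit, hrest, add_zero]⟩

end Helpers

/-! ### Peeling blocks (Lemma 3.9) and the homogeneity of linear-orbit members -/

section Peel

variable {K : Type*} [Field K] {n c : ℕ}

/-- **Lemma 3.9, as used in the proof of Thm 45**: to show that a `(k+1)`-independent map hits `f`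
it suffices that every `k`-independent map hits one directional derivative `∂f/∂v`.
[cite: MediniShpilka2021, Lemma 3.9 (CCC p.19:10; arXiv p0018) and proof of Thm 45 (p0036:L22, L50)] -/
theorem bind₁_ne_zero_of_forall_dirDeriv {k : ℕ}
    {G : Fin n → MvPolynomial (Fin (k + 1) × (Fin c ⊕ Unit)) K} (hG : IsIndependent (k + 1) G)
    (f : MvPolynomial (Fin n) K) (v : Fin n → K)
    (h : ∀ G' : Fin n → MvPolynomial (Fin k × (Fin c ⊕ Unit)) K, IsIndependent k G' →
      bind₁ G' (∑ i, C (v i) * pderiv i f) ≠ 0) :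
    bind₁ G f ≠ 0 := by
  obtain ⟨G₁, G', hG₁, hG', hGeq⟩ := isIndependent_succ_iff.1 hG
  have hfun : G = fun j => rename (Prod.mk 0) (G₁ j) + rename (Prod.map Fin.succ id) (G' j) :=
    funext hGeq
  rw [hfun]
  exact bind₁_peel_ne_zero_of_dirDeriv hG₁ G' f v (h G' hG')

/-- Two peeled blocks: a `(k+2)`-independent map hits `f` as soon as every `k`-independent map hits
one second directional derivative `∂²f/∂u∂w` ("by Lemma 3.9, any uniform `6`-independent map hits
`f`"). [cite: MediniShpilka2021, Lemma 3.9 and proof of Thm 45 (arXiv p0036:L50)] -/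
theorem bind₁_ne_zero_of_forall_dirDeriv_dirDeriv {k : ℕ}
    {G : Fin n → MvPolynomial (Fin (k + 2) × (Fin c ⊕ Unit)) K} (hG : IsIndependent (k + 2) G)
    (f : MvPolynomial (Fin n) K) (u w : Fin n → K)
    (h : ∀ G'' : Fin n → MvPolynomial (Fin k × (Fin c ⊕ Unit)) K, IsIndependent k G'' →
      bind₁ G'' (∑ i, C (u i) * pderiv i (∑ i', C (w i') * pderiv i' f)) ≠ 0) :
    bind₁ G f ≠ 0 :=
  bind₁_ne_zero_of_forall_dirDeriv hG f w fun _ hG' =>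
    bind₁_ne_zero_of_forall_dirDeriv hG' _ u fun G'' hG'' => h G'' hG''

/-- Members of the linear orbit `T_{s,d}^{GL_n}` are homogeneous of degree `d`
("`f_1^{[d_1]} = T_{s₁,d₁}(ℓ^{[1]}, …)`" — for linear orbits `f₁ = f₁^{[d₁]}`).
[cite: MediniShpilka2021, proof of Thm 45 (arXiv p0036:L6-L8)] -/
theorem isHomogeneous_of_mem_linOrbit_sdm {s d : ℕ} {f : MvPolynomial (Fin n) K}
    (hf : f ∈ linOrbit n (sdm K s d)) : f.IsHomogeneous d := by
  obtain ⟨h, A, hA, rfl⟩ := exists_affSubst_of_mem_linOrbit_sdm hf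
  exact isHomogeneous_affSubst_zero h A isHomogeneous_sum_prod_X.rename_isHomogeneous

/-- A nonzero LINEAR FORM is hit by every `k`-independent map, `k ≥ 1` (the case `d = 1` of Thm 45;
Obs 3.3: a `1`-independent map hits every nonzero linear function).
[cite: MediniShpilka2021, Obs 3.3 / Def 19 (arXiv p0006:L64-L67) and proof of Thm 45 (p0036)] -/
theorem bind₁_ne_zero_of_isHomogeneous_one {k : ℕ}
    {G : Fin n → MvPolynomial (Fin k × (Fin c ⊕ Unit)) K} (hG : IsIndependent k G) (hk : 1 ≤ k)
    {f : MvPolynomial (Fin n) K} (hf : f.IsHomogeneous 1) (hf0 : f ≠ 0) :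
    bind₁ G f ≠ 0 := by
  classical
  -- `f = ∑_j c_j x_j` with `c_j = coeff e_j f`
  have hrep : f = (∑ j, C (coeff (Finsupp.single j 1) f) * X j) + C 0 := by
    rw [C_0, add_zero]
    ext m
    rw [coeff_sum]
    simp only [coeff_C_mul, coeff_X, mul_ite, mul_one, mul_zero]
    by_cases hm : m.degree = 1
    · obtain ⟨j, rfl⟩ := exists_eq_single_of_degree_eq_one m hm
      rw [Finset.sum_eq_single j]
      · rw [if_pos rfl]
      · intro j' _ hj'
        rw [if_neg]
        intro hjj
        exact hj' (Finsupp.single_left_injective one_ne_zero hjj.symm).symm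
      · intro hj
        exact absurd (Finset.mem_univ j) hj
    · rw [hf.coeff_eq_zero hm]
      refine (Finset.sum_eq_zero fun j _ => if_neg ?_).symm
      rintro rfl
      exact hm (Finsupp.degree_single _ _)
  obtain ⟨j₀, hj₀⟩ : ∃ j, coeff (Finsupp.single j 1) f ≠ 0 := by
    by_contra hall
    push Not at hall
    apply hf0
    rw [hrep]
    simp [hall]
  rw [hrep]
  exact hG.bind₁_affine_ne_zero hk _ 0 ⟨j₀, hj₀⟩

end Peel

/-! ### Step 1: different degrees -/

section Steps

variable {K : Type*} [Field K] {n c : ℕ}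

/-- **Step 1 of the proof of Thm 45** ("we first prove that if `f ∘ G₆ = 0` then `d₁ = d₂`"): for
`d₁ ≠ d₂` every uniform `6`-independent map hits `f₁ - f₂ ≠ 0` — `f_i ∘ G` is homogeneous of degree
`d_i · deg G`, the nonzero `f_i` survive by Cor 6.3, and homogeneous polynomials of distinct degrees
do not cancel. Valid over every field. [cite: MediniShpilka2021, proof of Thm 45 (arXiv p0036:L5-L9)] -/
theorem bind₁_sub_ne_zero_of_degree_ne {s₁ s₂ d₁ d₂ : ℕ} (hd : d₁ ≠ d₂)
    {f₁ f₂ : MvPolynomial (Fin n) K}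
    (hf₁ : f₁ ∈ linOrbit n (sdm K s₁ d₁)) (hf₂ : f₂ ∈ linOrbit n (sdm K s₂ d₂)) (hne : f₁ - f₂ ≠ 0)
    {G : Fin n → MvPolynomial (Fin 6 × (Fin c ⊕ Unit)) K} (hG : IsIndependent 6 G)
    (hU : IsUniform G) : bind₁ G (f₁ - f₂) ≠ 0 := by
  classical
  obtain ⟨e, he⟩ := hU
  have hh₁ := isHomogeneous_of_mem_linOrbit_sdm hf₁
  have hh₂ := isHomogeneous_of_mem_linOrbit_sdm hf₂
  rw [map_sub, sub_ne_zero]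
  intro heq
  by_cases h10 : f₁ = 0
  · have h2 : f₂ ≠ 0 := by
      rintro rfl
      exact hne (by rw [h10, sub_zero])
    exact bind₁_ne_zero_of_mem_affOrbit_sdm (linOrbit_subset_affOrbit _ _ hf₂) h2 hG (by norm_num)
      (by rw [← heq, h10, map_zero])
  by_cases h20 : f₂ = 0
  · exact bind₁_ne_zero_of_mem_affOrbit_sdm (linOrbit_subset_affOrbit _ _ hf₁) h10 hG (by norm_num)
      (by rw [heq, h20, map_zero])
  have hb₁ : bind₁ G f₁ ≠ 0 :=
    bind₁_ne_zero_of_mem_affOrbit_sdm (linOrbit_subset_affOrbit _ _ hf₁) h10 hG (by norm_num)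
  -- there is a variable (else both `f_i` are constants of degree `0 = d₁ = d₂`), hence `e ≥ 1`
  have hn : Nonempty (Fin n) := by
    by_contra h0
    rw [not_nonempty_iff] at h0
    have e1 : d₁ = 0 :=
      hh₁.inj_right (by rw [eq_C_of_isEmpty f₁]; exact isHomogeneous_C _ _) h10
    have e2 : d₂ = 0 :=
      hh₂.inj_right (by rw [eq_C_of_isEmpty f₂]; exact isHomogeneous_C _ _) h20
    exact hd (e1.trans e2.symm)
  obtain ⟨i₀⟩ := hn
  have he1 : 1 ≤ e := one_le_of_isUniform_isIndependent hG (by norm_num) he i₀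
  have hB₁ : (bind₁ G f₁).IsHomogeneous (d₁ * e) := isHomogeneous_bind₁_of_forall hh₁ G he
  have hB₂ : (bind₁ G f₂).IsHomogeneous (d₂ * e) := isHomogeneous_bind₁_of_forall hh₂ G he
  rw [← heq] at hB₂
  exact hd (Nat.eq_of_mul_eq_mul_right he1 (hB₁.inj_right hB₂ hb₁))

/-! ### Step 2(a): a form of the second family outside the span of the first -/

/-- **Thm 45, the span case** ("there must exist a linear form `ℓ_{1,1,1} ∉ span{ℓ_{2,i,j}}` … fix
a vector `v` such that `ℓ_{1,1,1}(v) = 1` and `ℓ_{2,i,j}(v) = 0` … `∂f₂/∂v = 0` … `∂f₁/∂v ≠ 0` …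
from Lemma 3.9 and Lemma 6.2 we conclude", p0036:L16-L24; here with the roles of the two families
as displayed: the EXCEPTIONAL form is `ℓ_{1,v₀}`, the derivative kills `f₂`). `d ≥ 2`; every field.
[cite: MediniShpilka2021, proof of Thm 45 (arXiv p0036:L16-L24)] -/
theorem bind₁_sub_ne_zero_of_notMem_span {s₁ s₂ d : ℕ} (hd : 2 ≤ d) (h₁ : s₁ * d ≤ n)
    (h₂ : s₂ * d ≤ n) {A₁ : Matrix (Fin n) (Fin n) K} (A₂ : Matrix (Fin n) (Fin n) K)
    (hA₁ : IsUnit A₁.det) (v₀ : Fin s₁ × Fin d)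
    (hv₀ : (fun k => A₁ (Fin.castLE h₁ (finProdFinEquiv v₀)) k) ∉
      Submodule.span K (Set.range fun v : Fin s₂ × Fin d =>
        fun k => A₂ (Fin.castLE h₂ (finProdFinEquiv v)) k))
    {G : Fin n → MvPolynomial (Fin 6 × (Fin c ⊕ Unit)) K} (hG : IsIndependent 6 G) :
    bind₁ G (affSubst h₁ A₁ 0 (rename finProdFinEquiv (∑ a : Fin s₁, ∏ j : Fin d, X (a, j))) -
      affSubst h₂ A₂ 0 (rename finProdFinEquiv (∑ a : Fin s₂, ∏ j : Fin d, X (a, j)))) ≠ 0 := by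
  classical
  obtain ⟨v, hv1, hv2⟩ := exists_dotProduct_eq_one_of_notMem_span _ _ hv₀
  refine bind₁_ne_zero_of_forall_dirDeriv hG _ v fun G' hG' => ?_
  -- `∂f₂/∂v = 0`
  have hD₂ : (∑ j, C (v j) * pderiv j (affSubst h₂ A₂ 0
      (rename finProdFinEquiv (∑ a : Fin s₂, ∏ j : Fin d, X (a, j))))) = 0 := by
    rw [dirDeriv_affSubst_rename]
    have h0 : ∀ w : Fin s₂ × Fin d, (A₂ *ᵥ v) (Fin.castLE h₂ (finProdFinEquiv w)) = 0 :=
      fun w => hv2 w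
    simp only [h0, zero_mul, Finset.sum_const_zero, map_zero, affSubst_zero']
  -- `∂f₁/∂v ≠ 0`
  have hD₁ : (∑ j, C (v j) * pderiv j (affSubst h₁ A₁ 0
      (rename finProdFinEquiv (∑ a : Fin s₁, ∏ j : Fin d, X (a, j))))) ≠ 0 := by
    rw [dirDeriv_affSubst_rename]
    intro h0
    have h0' := eq_zero_of_affSubst_eq_zero h₁ hA₁ 0 h0
    rw [map_eq_zero_iff _ (rename_injective _ finProdFinEquiv.injective)] at h0'
    refine dirDeriv_sum_prod_X_ne_zero hd _ v₀ ?_ h0'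
    change (fun k => A₁ (Fin.castLE h₁ (finProdFinEquiv v₀)) k) ⬝ᵥ v ≠ 0
    rw [hv1]
    exact one_ne_zero
  rw [dirDeriv_sub', hD₂, sub_zero]
  exact bind₁_dirDeriv_ne_zero_of_mem_affOrbit_sdm ⟨h₁, A₁, 0, hA₁, by rw [sdm_eq_rename]⟩ v hD₁
    hG' (by norm_num)

/-! ### Step 2(b): the second family inside the span of the first -/

/-- **Thm 45, the in-span case** ("we can represent `f₂` as a polynomial in `{ℓ_{1,i,j}}` … two
cases, depending on the `{ℓ_1}`-monomials appearing in `f₂`", p0036:L26-L50), `d ≥ 2`, under the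
hypothesis that `2, …, d` are nonzero in `K` (used only in the sub-case "some `a_{i,j} ≥ 2`",
p0036:L38-L42 — see the CHARACTERISTIC NOTE in the module docstring).
[cite: MediniShpilka2021, proof of Thm 45 (arXiv p0036:L26-L50)] -/
theorem bind₁_sub_ne_zero_of_forall_mem_span {s₁ s₂ d : ℕ} (hd : 2 ≤ d)
    (hchar : ∀ q : ℕ, 2 ≤ q → q ≤ d → (q : K) ≠ 0) (h₁ : s₁ * d ≤ n) (h₂ : s₂ * d ≤ n)
    {A₁ A₂ : Matrix (Fin n) (Fin n) K} (hA₁ : IsUnit A₁.det) (hA₂ : IsUnit A₂.det)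
    (hspan : ∀ v : Fin s₂ × Fin d, (fun k => A₂ (Fin.castLE h₂ (finProdFinEquiv v)) k) ∈
      Submodule.span K (Set.range fun w : Fin s₁ × Fin d =>
        fun k => A₁ (Fin.castLE h₁ (finProdFinEquiv w)) k))
    (hne : affSubst h₁ A₁ 0 (rename finProdFinEquiv (∑ a : Fin s₁, ∏ j : Fin d, X (a, j))) -
      affSubst h₂ A₂ 0 (rename finProdFinEquiv (∑ a : Fin s₂, ∏ j : Fin d, X (a, j))) ≠ 0)
    {G : Fin n → MvPolynomial (Fin 6 × (Fin c ⊕ Unit)) K} (hG : IsIndependent 6 G) :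
    bind₁ G (affSubst h₁ A₁ 0 (rename finProdFinEquiv (∑ a : Fin s₁, ∏ j : Fin d, X (a, j))) -
      affSubst h₂ A₂ 0 (rename finProdFinEquiv (∑ a : Fin s₂, ∏ j : Fin d, X (a, j)))) ≠ 0 := by
  classical
  have hd0 : 0 < d := by omega
  -- the change of basis `ℓ_{2,v} = ∑_w M_{v,w} ℓ_{1,w}` and `f₂ = P(ℓ_1)`, `P = T'_{s₂,d} ∘ M`
  obtain ⟨M, hM⟩ := exists_matrix_of_forall_mem_span
    (fun w : Fin s₁ × Fin d => fun k => A₁ (Fin.castLE h₁ (finProdFinEquiv w)) k)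
    (fun v : Fin s₂ × Fin d => fun k => A₂ (Fin.castLE h₂ (finProdFinEquiv v)) k) hspan
  obtain ⟨P, hP⟩ : ∃ P : MvPolynomial (Fin s₁ × Fin d) K,
      aeval (fun v : Fin s₂ × Fin d => ∑ w : Fin s₁ × Fin d, (C (M v w) * X w :
        MvPolynomial (Fin s₁ × Fin d) K))
        (∑ a : Fin s₂, ∏ j : Fin d, X (a, j) : MvPolynomial (Fin s₂ × Fin d) K) = P := ⟨_, rfl⟩
  have hf₂ : affSubst h₂ A₂ 0 (rename finProdFinEquiv (∑ a : Fin s₂, ∏ j : Fin d, X (a, j))) =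
      affSubst h₁ A₁ 0 (rename finProdFinEquiv P) := by
    rw [← hP]
    exact affSubst_rename_eq_of_rows_eq h₁ h₂ A₁ A₂ M hM _
  have hPhom : P.IsHomogeneous d := by
    rw [← hP]
    have := (isHomogeneous_sum_prod_X (K := K) (s := s₂) (d := d)).aeval
      (fun v => ∑ w, C (M v w) * X w)
      (fun v => IsHomogeneous.sum _ _ _ fun w _ => isHomogeneous_C_mul_X _ _)
    rwa [one_mul] at this
  have hf₂orb : affSubst h₁ A₁ 0 (rename finProdFinEquiv P) ∈ affOrbit n (sdm K s₂ d) :=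
    ⟨h₂, A₂, 0, hA₂, by rw [← hf₂, sdm_eq_rename]⟩
  -- `f = Q(ℓ_1)`, `Q = T'_{s₁,d} - P ≠ 0`
  have hf : affSubst h₁ A₁ 0 (rename finProdFinEquiv (∑ a : Fin s₁, ∏ j : Fin d, X (a, j))) -
      affSubst h₂ A₂ 0 (rename finProdFinEquiv (∑ a : Fin s₂, ∏ j : Fin d, X (a, j))) =
      affSubst h₁ A₁ 0 (rename finProdFinEquiv ((∑ a : Fin s₁, ∏ j : Fin d, X (a, j)) - P)) := by
    rw [hf₂, map_sub, affSubst_sub']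
  rw [hf] at hne ⊢
  have hQ0 : (∑ a : Fin s₁, ∏ j : Fin d, X (a, j) : MvPolynomial (Fin s₁ × Fin d) K) - P ≠ 0 := by
    intro h0
    exact hne (by rw [h0, map_zero, affSubst_zero'])
  by_cases hA : ∀ α ∈ P.support, ∃ a : Fin s₁, α = ∑ j : Fin d, Finsupp.single (a, j) 1
  · /- Case A ("the `{ℓ_1}`-monomials of `f₂` are `{ℓ_1}`-monomials of `f₁`"): `Q` is a nonzero
    combination of row monomials; differentiate once along the dual vector of `x_{(a₀,0)}`. -/
    have hQ : ∀ α ∈ ((∑ a : Fin s₁, ∏ j : Fin d, X (a, j) : MvPolynomial (Fin s₁ × Fin d) K) -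
        P).support, ∃ a : Fin s₁, α = ∑ j : Fin d, Finsupp.single (a, j) 1 := by
      intro α hα
      rcases Finset.mem_union.1 (support_sub _ _ _ hα) with hT | hP'
      · have hc := mem_support_iff.1 hT
        rw [coeff_sum_prod_X hd0] at hc
        by_contra hno
        exact hc (if_neg hno)
      · exact hA α hP'
    obtain ⟨α₀, hα₀⟩ := ne_zero_iff.1 hQ0
    obtain ⟨a₀, rfl⟩ := hQ α₀ (mem_support_iff.2 hα₀)
    refine bind₁_ne_zero_of_forall_dirDeriv hG _
      (fun j => A₁⁻¹ j (Fin.castLE h₁ (finProdFinEquiv (a₀, (⟨0, hd0⟩ : Fin d))))) fun G' hG' => ?_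
    rw [dualDeriv_affSubst_rename h₁ hA₁, pderiv_eq_C_mul_prod_of_rows _ hQ a₀ ⟨0, hd0⟩]
    simp only [affSubst, map_mul, map_prod, rename_X, algHom_C, algebraMap_eq, aeval_X]
    refine mul_ne_zero (C_ne_zero.2 hα₀) (Finset.prod_ne_zero_iff.2 fun j _ => ?_)
    obtain ⟨k₀, hk₀⟩ := exists_apply_ne_zero_of_isUnit_det hA₁ (Fin.castLE h₁ (finProdFinEquiv (a₀, j)))
    exact hG'.bind₁_affine_ne_zero (by norm_num) _ _ ⟨k₀, hk₀⟩
  · /- Case B ("there exists an `{ℓ_1}`-monomial `∏ ℓ_{i,j}^{a_{i,j}}` in `f₂` that is not one of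
    `f₁`"): choose two dual directions killing `f₁` but not `f₂`, then the engine with `k = 2`. -/
    push Not at hA
    obtain ⟨α, hαP, hrow⟩ := hA
    have hcP : coeff α P ≠ 0 := mem_support_iff.1 hαP
    have hdeg : α.degree = d := by
      by_contra h
      exact hcP (hPhom.coeff_eq_zero h)
    obtain ⟨v₀, v₁, hT0, hP0⟩ : ∃ v₀ v₁ : Fin s₁ × Fin d,
        pderiv v₀ (pderiv v₁ (∑ a : Fin s₁, ∏ j : Fin d, X (a, j) :
          MvPolynomial (Fin s₁ × Fin d) K)) = 0 ∧ pderiv v₀ (pderiv v₁ P) ≠ 0 := by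
      by_cases hml : ∀ v, α v ≤ 1
      · -- all `a_{i,j} ≤ 1`: two variables of `α` in different rows (p0036:L44-L47)
        obtain ⟨v₀, hv₀, v₁, hv₁, hne'⟩ := exists_two_rows_of_not_row hd0 α hdeg hml hrow
        have hv₀1 : α v₀ = 1 :=
          le_antisymm (hml v₀) (Nat.one_le_iff_ne_zero.2 (Finsupp.mem_support_iff.1 hv₀))
        have hv₁1 : α v₁ = 1 :=
          le_antisymm (hml v₁) (Nat.one_le_iff_ne_zero.2 (Finsupp.mem_support_iff.1 hv₁))
        have hvv : v₀ ≠ v₁ := fun h => hne' (by rw [h])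
        refine ⟨v₀, v₁, pderiv_pderiv_sum_prod_X v₀ v₁ (Or.inr hne'), fun h0 => hcP ?_⟩
        have := coeff_pderiv_pderiv_of_ne P v₀ v₁ hvv α hv₀1 hv₁1
        rw [h0, coeff_zero] at this
        exact this.symm
      · -- some `a_{i,j} ≥ 2`: `u = w = v_{i,j}` (p0036:L38-L42) — THE characteristic-sensitive step
        push Not at hml
        obtain ⟨v₀, hv₀⟩ := hml
        refine ⟨v₀, v₀, pderiv_pderiv_sum_prod_X v₀ v₀ (Or.inl rfl), fun h0 => ?_⟩
        have := coeff_pderiv_pderiv_of_two_le P v₀ α hv₀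
        rw [h0, coeff_zero] at this
        have hαd : α v₀ ≤ d := (Finsupp.le_degree v₀ α).trans hdeg.le
        have hq1 : ((α v₀ - 1 : ℕ) : K) ≠ 0 := by
          rcases Nat.lt_or_ge (α v₀ - 1) 2 with hlt | hge
          · have : α v₀ - 1 = 1 := by omega
            rw [this, Nat.cast_one]
            exact one_ne_zero
          · exact hchar _ hge (by omega)
        exact mul_ne_zero (mul_ne_zero hcP hq1) (hchar _ hv₀ hαd) this.symm
    -- the dual directions `u = v_{v₀}`, `w = v_{v₁}` (columns of `A₁⁻¹`)
    have hDD : ∀ q : MvPolynomial (Fin s₁ × Fin d) K,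
        (∑ j, C (A₁⁻¹ j (Fin.castLE h₁ (finProdFinEquiv v₀))) * pderiv j
          (∑ j', C (A₁⁻¹ j' (Fin.castLE h₁ (finProdFinEquiv v₁))) * pderiv j'
            (affSubst h₁ A₁ 0 (rename finProdFinEquiv q)))) =
          affSubst h₁ A₁ 0 (rename finProdFinEquiv (pderiv v₀ (pderiv v₁ q))) := by
      intro q
      rw [dualDeriv_affSubst_rename h₁ hA₁, dualDeriv_affSubst_rename h₁ hA₁]
    refine bind₁_ne_zero_of_forall_dirDeriv_dirDeriv hG _
      (fun j => A₁⁻¹ j (Fin.castLE h₁ (finProdFinEquiv v₀)))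
      (fun j => A₁⁻¹ j (Fin.castLE h₁ (finProdFinEquiv v₁))) fun G'' hG'' => ?_
    -- `∂²f/∂u∂w = -∂²f₂/∂u∂w ≠ 0`
    have hkey : (∑ j, C (A₁⁻¹ j (Fin.castLE h₁ (finProdFinEquiv v₀))) * pderiv j
        (∑ j', C (A₁⁻¹ j' (Fin.castLE h₁ (finProdFinEquiv v₁))) * pderiv j'
          (affSubst h₁ A₁ 0 (rename finProdFinEquiv
            ((∑ a : Fin s₁, ∏ j : Fin d, X (a, j)) - P))))) =
        -(∑ j, C (A₁⁻¹ j (Fin.castLE h₁ (finProdFinEquiv v₀))) * pderiv j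
          (∑ j', C (A₁⁻¹ j' (Fin.castLE h₁ (finProdFinEquiv v₁))) * pderiv j'
            (affSubst h₁ A₁ 0 (rename finProdFinEquiv P)))) := by
      rw [hDD, hDD, map_sub, map_sub, hT0, zero_sub, map_neg, affSubst_neg']
    have hne2 : (∑ j, C (A₁⁻¹ j (Fin.castLE h₁ (finProdFinEquiv v₀))) * pderiv j
        (∑ j', C (A₁⁻¹ j' (Fin.castLE h₁ (finProdFinEquiv v₁))) * pderiv j'
          (affSubst h₁ A₁ 0 (rename finProdFinEquiv P)))) ≠ 0 := by
      rw [hDD]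
      intro h0
      have h0' := eq_zero_of_affSubst_eq_zero h₁ hA₁ 0 h0
      rw [map_eq_zero_iff _ (rename_injective _ finProdFinEquiv.injective)] at h0'
      exact hP0 h0'
    rw [hkey, map_neg, neg_ne_zero]
    exact bind₁_dirDeriv_dirDeriv_ne_zero_of_mem_affOrbit_sdm hf₂orb _ _ hne2 hG'' le_rfl

end Steps

/-! ### The theorem -/

section Main

/-- **MS Thm 45, for fields in which `2, …, min(d₁, d₂)` are nonzero** (characteristic `0` or
`> min(d₁, d₂)`): "Let `n ≥ s₁d₁, s₂d₂`, `f_i ∈ T_{s_i,d_i}^{GL_n(F)}`, `f = f₁ - f₂`. If `f ≠ 0`,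
then any uniform `6`-independent `G` satisfies `f ∘ G ≠ 0`." The characteristic hypothesis is used
only in the printed sub-case "some `a_{i,j} ≥ 2`" (p0036:L38-L42), see the module docstring; the
hypotheses `n ≥ s_i d_i` of the printed statement are implied by the orbit memberships and omitted.
[cite: MediniShpilka2021, Thm 45 (CCC p.19:14; arXiv ‹PITsumSDMinv› p0009:L9-L12), proof §6.2 (p0036:L1-L52)] -/
theorem thm_45_of_cast_ne_zero (K : Type*) [Field K] (n s₁ s₂ d₁ d₂ c : ℕ)
    (hchar : ∀ q : ℕ, 2 ≤ q → q ≤ min d₁ d₂ → (q : K) ≠ 0)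
    {f₁ : MvPolynomial (Fin n) K} (hf₁ : f₁ ∈ linOrbit n (sdm K s₁ d₁))
    {f₂ : MvPolynomial (Fin n) K} (hf₂ : f₂ ∈ linOrbit n (sdm K s₂ d₂)) (hne : f₁ - f₂ ≠ 0)
    {G : Fin n → MvPolynomial (Fin 6 × (Fin c ⊕ Unit)) K} (hG : IsIndependent 6 G)
    (hU : IsUniform G) : bind₁ G (f₁ - f₂) ≠ 0 := by
  classical
  by_cases hd : d₁ = d₂
  swap
  · exact bind₁_sub_ne_zero_of_degree_ne hd hf₁ hf₂ hne hG hU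
  subst hd
  have hhom : (f₁ - f₂).IsHomogeneous d₁ :=
    (isHomogeneous_of_mem_linOrbit_sdm hf₁).sub (isHomogeneous_of_mem_linOrbit_sdm hf₂)
  rcases Nat.lt_or_ge d₁ 2 with hlt | hge
  · interval_cases d₁
    · -- `d = 0`: `f` is a nonzero constant
      have h0 : (f₁ - f₂).totalDegree = 0 := Nat.le_zero.1 hhom.totalDegree_le
      rw [totalDegree_eq_zero_iff_eq_C] at h0
      rw [h0, bind₁_C_right]
      intro hC
      rw [C_eq_zero] at hC
      exact hne (by rw [h0, hC, C_0])
    · -- `d = 1`: `f` is a nonzero linear form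
      exact bind₁_ne_zero_of_isHomogeneous_one hG (by norm_num) hhom hne
  -- `d ≥ 2`
  obtain ⟨h₁, A₁, hA₁, rfl⟩ := exists_affSubst_of_mem_linOrbit_sdm hf₁
  obtain ⟨h₂, A₂, hA₂, rfl⟩ := exists_affSubst_of_mem_linOrbit_sdm hf₂
  by_cases hspan : ∀ v : Fin s₂ × Fin d₁, (fun k => A₂ (Fin.castLE h₂ (finProdFinEquiv v)) k) ∈
      Submodule.span K (Set.range fun w : Fin s₁ × Fin d₁ =>
        fun k => A₁ (Fin.castLE h₁ (finProdFinEquiv w)) k)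
  · exact bind₁_sub_ne_zero_of_forall_mem_span hge (fun q hq hqd => hchar q hq (by simpa using hqd))
      h₁ h₂ hA₁ hA₂ hspan hne hG
  · push Not at hspan
    obtain ⟨v₀, hv₀⟩ := hspan
    have := bind₁_sub_ne_zero_of_notMem_span hge h₂ h₁ A₁ hA₂ v₀ hv₀ hG
    rwa [← neg_sub, map_neg, neg_ne_zero] at this

/-- **MS Thm 45 in characteristic `0`**, in the binder shape of the fact `MS2021_thm_45`.
[cite: MediniShpilka2021, Thm 45 (CCC p.19:14; arXiv ‹PITsumSDMinv› p0009:L9-L12)] -/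
theorem thm_45_of_charZero (K : Type) [Field K] [CharZero K] (n s₁ s₂ d₁ d₂ c : ℕ) :
    s₁ * d₁ ≤ n → s₂ * d₂ ≤ n →
      ∀ f₁ ∈ linOrbit n (sdm K s₁ d₁), ∀ f₂ ∈ linOrbit n (sdm K s₂ d₂), f₁ - f₂ ≠ 0 →
        ∀ G : Fin n → MvPolynomial (Fin 6 × (Fin c ⊕ Unit)) K, IsIndependent 6 G → IsUniform G →
          bind₁ G (f₁ - f₂) ≠ 0 :=
  fun _ _ _ hf₁ _ hf₂ hne _ hG hU =>
    thm_45_of_cast_ne_zero K n s₁ s₂ d₁ d₂ c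
      (fun q hq _ => Nat.cast_ne_zero.2 (by omega)) hf₁ hf₂ hne hG hU

/-- **MS Thm 45 in characteristic `p > min(d₁, d₂)`**, in the binder shape of the fact.
[cite: MediniShpilka2021, Thm 45 (CCC p.19:14; arXiv ‹PITsumSDMinv› p0009:L9-L12)] -/
theorem thm_45_of_lt_ringChar (K : Type) [Field K] (n s₁ s₂ d₁ d₂ c : ℕ)
    (hp : min d₁ d₂ < ringChar K) :
    s₁ * d₁ ≤ n → s₂ * d₂ ≤ n →
      ∀ f₁ ∈ linOrbit n (sdm K s₁ d₁), ∀ f₂ ∈ linOrbit n (sdm K s₂ d₂), f₁ - f₂ ≠ 0 →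
        ∀ G : Fin n → MvPolynomial (Fin 6 × (Fin c ⊕ Unit)) K, IsIndependent 6 G → IsUniform G →
          bind₁ G (f₁ - f₂) ≠ 0 := by
  intro _ _ _ hf₁ _ hf₂ hne _ hG hU
  refine thm_45_of_cast_ne_zero K n s₁ s₂ d₁ d₂ c (fun q hq hqd hq0 => ?_) hf₁ hf₂ hne hG hU
  rw [ringChar.spec] at hq0
  have := Nat.le_of_dvd (by omega) hq0
  omega

end Main

end MS2021

end Literature.Computability.AlgebraicComplexity

end
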